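import Summits.BirchSwinnertonDyer.BirchSwinnertonDyer.Theorems.PlecticLegsKatoDescentAlgebra
import Literature.LinearAlgebra.CommonEigenvectorOfCommute
import HarnessLib

/-!
# BirchSwinnertonDyer / PlecticLegs — support item `KatoDescent` (stmt-BirchSwinnertonDyer-18262):
# torsion `χ`-parts force `rank M = rank M^G`

The "Galois-descent rank algebra" of the item, for an additive action `ρ` of a finite commutative
group `G` on a finitely generated abelian group `M` (later: `G = Gal(ℚ(ζ_m)/ℚ)` on
`M = E(ℚ(ζ_m))^H`):

* `exists_addMonoidHom_int_apply_ne_zero` — an element of infinite order of a finitely generated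
  abelian group is detected by an additive map to `ℤ` (free quotient by torsion);
* `exists_nsmul_forall_apply_eq` — **the core**: if for every non-trivial character
  `χ : G → ℂˣ` which is trivial on the kernel of the action, Kato's `χ`-part
  `M^(χ) = {x ; I_χ x = 0}` (`Literature.NumberTheory.EllipticCurves.chiPart`) is torsion, then every
  `x ∈ M` has a positive multiple fixed by `G`. Proof: otherwise the class of `x` in `M / M^G` has
  infinite order, giving an additive `f : M → ℂ` vanishing on `M^G` with `f x ≠ 0`; the `ℂ`-span of
  its `G`-translates is a non-zero finite-dimensional space of such functionals on which the
  commuting operators `φ ↦ φ ∘ ρ(g)` have a common eigenvector `φ`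
  (`Literature.LinearAlgebra.exists_ne_zero_forall_apply_eq_smul_of_commute`), `φ ∘ ρ(g) = χ(g) φ`;
  `χ ≠ 1` because `φ` kills norms; the witness `w = N_{ker χ}(Ψ_n(ρ g₀) x₀)` of
  `PlecticLegsKatoDescentAlgebra` lies in `M^(χ)` and `φ w = |ker χ| Ψ_n(ζ) φ x₀ ≠ 0`, so `w` has
  infinite order — contradiction;
* `finrank_eq_finrank_of_chiPart_torsion` — hence `rank_ℤ M = rank_ℤ M^G`
  (`M / M^G` is torsion; rank–nullity over `ℤ`);
* `finrank_fixed_eq_finrank_fixed_of_subgroup` — the form used by the item: for `H ≤ G`, if the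
  `χ`-parts of `M` for the non-trivial `χ` trivial on `H` are torsion then
  `rank_ℤ M^H = rank_ℤ M^G` (apply the core to `M^H`).

Everything is folklore (characters of finite abelian groups; e.g. the rank bookkeeping in
K. Rubin, *Euler systems*, Annals of Math. Studies 147, §3.5, or Kato, Astérisque 295, p. 236).
-/

set_option linter.dupNamespace false

noncomputable section

open scoped BigOperators Classical
open Polynomial Literature.NumberTheory.EllipticCurves Module

namespace Summit.BirchSwinnertonDyer.BirchSwinnertonDyer.Theorems

namespace KatoDescent

/-! ### Functionals on finitely generated abelian groups -/

/-- **An element of infinite order is detected by a functional**: in a finitely generated abelian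
group `Q`, if `n • q ≠ 0` for all `n > 0` then some additive `f : Q → ℤ` has `f q ≠ 0`
(`Q / Q_tors` is free, Mathlib `Module.free_of_finite_type_torsion_free'`, and `q ∉ Q_tors`).
[folklore] -/
theorem exists_addMonoidHom_int_apply_ne_zero {Q : Type*} [AddCommGroup Q] [Module.Finite ℤ Q]
    {q : Q} (hq : ∀ n : ℕ, 0 < n → n • q ≠ 0) : ∃ f : Q →+ ℤ, f q ≠ 0 := by
  set T := Submodule.torsion ℤ Q with hT
  haveI : Module.Finite ℤ (Q ⧸ T) := Module.Finite.quotient ℤ T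
  haveI : Module.IsTorsionFree ℤ (Q ⧸ T) := Submodule.QuotientTorsion.instIsTorsionFree
  haveI : Module.Free ℤ (Q ⧸ T) := Module.free_of_finite_type_torsion_free'
  have hq' : T.mkQ q ≠ 0 := by
    intro h
    rw [Submodule.mkQ_apply, Submodule.Quotient.mk_eq_zero, hT, Submodule.mem_torsion_iff] at h
    obtain ⟨a, ha⟩ := h
    have ha0 : (a : ℤ) ≠ 0 := nonZeroDivisors.coe_ne_zero a
    refine hq (a : ℤ).natAbs (Int.natAbs_pos.mpr ha0) ?_
    exact natAbs_nsmul_eq_zero.mpr ha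
  set b := Module.Free.chooseBasis ℤ (Q ⧸ T)
  have hb : b.repr (T.mkQ q) ≠ 0 := fun h => hq' (b.repr.map_eq_zero_iff.mp h)
  obtain ⟨i, hi⟩ := Finsupp.ne_iff.mp hb
  refine ⟨((b.coord i).comp T.mkQ).toAddMonoidHom, ?_⟩
  change b.repr (T.mkQ q) i ≠ 0
  simpa using hi

/-! ### The core -/

variable {M : Type*} [AddCommGroup M] {G : Type*} [CommGroup G] [Fintype G]
  (ρ : G → M →+ M) (hmul : ∀ (g h : G) (x : M), ρ (g * h) x = ρ g (ρ h x))
  (hone : ∀ x : M, ρ 1 x = x)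

include hmul hone in
/-- **Torsion `χ`-parts force `M / M^G` to be torsion.** Let the finite commutative group `G` act
additively on the finitely generated abelian group `M`. If for every non-trivial character
`χ : G → ℂˣ` trivial on every `g` acting as the identity the `χ`-part `M^(χ)` is torsion, then
every `x ∈ M` has a multiple `n • x`, `n > 0`, fixed by `G`. (See the module docstring for the
proof.) [folklore] -/
theorem exists_nsmul_forall_apply_eq [Module.Finite ℤ M]
    (htors : ∀ χ : G →* ℂˣ, χ ≠ 1 → (∀ g : G, (∀ x : M, ρ g x = x) → χ g = 1) →
      ∀ x ∈ chiPart ρ (fun g => (χ g : ℂ)), IsOfFinAddOrder x)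
    (x : M) : ∃ n : ℕ, 0 < n ∧ ∀ g : G, ρ g (n • x) = n • x := by
  by_contra hx
  push Not at hx
  -- the submodule of `G`-fixed vectors and the class of `x` modulo it
  let MG : Submodule ℤ M :=
    { carrier := {y | ∀ g : G, ρ g y = y}
      add_mem' := fun {a b} ha hb g => by rw [map_add, ha g, hb g]
      zero_mem' := fun g => map_zero _
      smul_mem' := fun c {y} hy g => by rw [map_zsmul, hy g] }
  have hMG : ∀ y : M, y ∈ MG ↔ ∀ g, ρ g y = y := fun y => Iff.rfl
  haveI : Module.Finite ℤ (M ⧸ MG) := Module.Finite.quotient ℤ MG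
  have hq : ∀ n : ℕ, 0 < n → n • MG.mkQ x ≠ 0 := by
    intro n hn h
    rw [← map_nsmul, Submodule.mkQ_apply, Submodule.Quotient.mk_eq_zero, hMG] at h
    obtain ⟨g, hg⟩ := hx n hn
    exact hg (h g)
  obtain ⟨f, hf⟩ := exists_addMonoidHom_int_apply_ne_zero hq
  -- an additive `f₀ : M → ℂ` vanishing on `M^G` with `f₀ x ≠ 0`
  let f₀ : M →+ ℂ := (Int.castAddHom ℂ).comp (f.comp MG.mkQ.toAddMonoidHom)
  have hf₀G : ∀ y : M, (∀ g, ρ g y = y) → f₀ y = 0 := by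
    intro y hy
    have h0 : MG.mkQ y = 0 := by
      rw [Submodule.mkQ_apply, Submodule.Quotient.mk_eq_zero]
      exact hy
    simp [f₀, h0]
  have hf₀x : f₀ x ≠ 0 := by simpa [f₀] using hf
  -- functionals vanishing on `M^G`, the operators `φ ↦ φ ∘ ρ g`, the span `V` of the orbit of `f₀`
  let A : Submodule ℂ (M →+ ℂ) :=
    { carrier := {φ | ∀ y : M, (∀ g, ρ g y = y) → φ y = 0}
      add_mem' := fun {a b} ha hb y hy => by
        rw [AddMonoidHom.add_apply, ha y hy, hb y hy, add_zero]
      zero_mem' := fun y _ => rfl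
      smul_mem' := fun c {φ} hφ y hy => by
        rw [AddMonoidHom.smul_apply, hφ y hy, smul_zero] }
  let T : G → Module.End ℂ (M →+ ℂ) := fun g =>
    { toFun := fun φ => φ.comp (ρ g)
      map_add' := fun φ ψ => by ext; simp
      map_smul' := fun c φ => by ext; simp }
  have hT : ∀ (g : G) (φ : M →+ ℂ) (y : M), T g φ y = φ (ρ g y) := fun _ _ _ => rfl
  let V : Submodule ℂ (M →+ ℂ) := Submodule.span ℂ (Set.range fun g : G => f₀.comp (ρ g))
  have hVA : V ≤ A := by
    refine Submodule.span_le.mpr ?_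
    rintro _ ⟨g, rfl⟩ y hy
    show f₀ (ρ g y) = 0
    rw [hy g]
    exact hf₀G y hy
  have hTV : ∀ g : G, ∀ v ∈ V, T g v ∈ V := by
    intro g v hv
    refine Submodule.span_induction (p := fun v _ => T g v ∈ V) ?_ ?_ ?_ ?_ hv
    · rintro _ ⟨g', rfl⟩
      refine Submodule.subset_span ⟨g' * g, ?_⟩
      ext y
      show f₀ (ρ (g' * g) y) = f₀ (ρ g' (ρ g y))
      rw [hmul]
    · rw [map_zero]
      exact V.zero_mem
    · intro u u' _ _ hu hu'
      rw [map_add]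
      exact V.add_mem hu hu'
    · intro c u _ hu
      rw [map_smul]
      exact V.smul_mem c hu
  haveI : FiniteDimensional ℂ V := FiniteDimensional.span_of_finite ℂ (Set.finite_range _)
  have hf₀V : f₀ ∈ V := by
    refine Submodule.subset_span ⟨1, ?_⟩
    ext y
    show f₀ (ρ 1 y) = f₀ y
    rw [hone]
  haveI : Nontrivial V := ⟨⟨⟨f₀, hf₀V⟩, 0, fun h => hf₀x (by
    have := congrArg (fun v : V => (v : M →+ ℂ) x) h
    simpa using this)⟩⟩
  let T' : G → Module.End ℂ V := fun g => (T g).restrict (hTV g)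
  have hT' : ∀ (g : G) (v : V), ((T' g v : V) : M →+ ℂ) = T g (v : M →+ ℂ) := fun _ _ => rfl
  have hcomm : ∀ g h : G, Commute (T' g) (T' h) := fun g h => by
    refine LinearMap.ext fun v => Subtype.ext (AddMonoidHom.ext fun y => ?_)
    show (v : M →+ ℂ) (ρ h (ρ g y)) = (v : M →+ ℂ) (ρ g (ρ h y))
    rw [← hmul, ← hmul, mul_comm]
  -- a common eigenvector `φ` : `φ ∘ ρ g = μ g • φ`
  obtain ⟨v, hv0, hv⟩ :=
    Literature.LinearAlgebra.exists_ne_zero_forall_apply_eq_smul_of_commute T' hcomm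
  choose μ hμ using hv
  set φ : M →+ ℂ := (v : M →+ ℂ) with hφdef
  have hφ : ∀ (g : G) (y : M), φ (ρ g y) = μ g * φ y := by
    intro g y
    have h := congrArg (fun w : V => (w : M →+ ℂ) y) (hμ g)
    simp only [hT', hT, Submodule.coe_smul, AddMonoidHom.smul_apply, smul_eq_mul] at h
    exact h
  have hφA : ∀ y : M, (∀ g, ρ g y = y) → φ y = 0 := hVA v.2
  have hφ0 : φ ≠ 0 := fun h => hv0 (Subtype.ext h)
  obtain ⟨x₀, hx₀⟩ : ∃ x₀, φ x₀ ≠ 0 := by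
    by_contra h
    push Not at h
    exact hφ0 (AddMonoidHom.ext h)
  -- `μ` is a character `χ : G → ℂˣ`
  have hμ1 : μ 1 = 1 := by
    have h := hφ 1 x₀
    rw [hone] at h
    exact ((mul_eq_right₀ hx₀).mp h.symm)
  have hμmul : ∀ g h : G, μ (g * h) = μ g * μ h := by
    intro g h
    have e1 : μ (g * h) * φ x₀ = μ g * (μ h * φ x₀) := by
      rw [← hφ h x₀, ← hφ g, ← hmul, hφ]
    rw [← mul_assoc] at e1
    exact mul_right_cancel₀ hx₀ e1
  let μ' : G →* ℂ := { toFun := μ, map_one' := hμ1, map_mul' := hμmul }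
  let χ : G →* ℂˣ := μ'.toHomUnits
  have hχμ : ∀ g, (χ g : ℂ) = μ g := fun g => rfl
  have hφχ : ∀ (g : G) (y : M), φ (ρ g y) = (χ g : ℂ) * φ y := fun g y => by rw [hχμ, hφ]
  have hχker : ∀ g : G, (∀ y : M, ρ g y = y) → χ g = 1 := by
    intro g hg
    ext
    rw [hχμ, Units.val_one]
    have h := hφ g x₀
    rw [hg] at h
    exact (mul_eq_right₀ hx₀).mp h.symm
  have hχ1 : χ ≠ 1 := by
    intro h1
    -- `φ` kills the norm `N_G x₀`, which is `G`-fixed; but `φ (N_G x₀) = |G| φ x₀`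
    have hN : φ (∑ d : (⊤ : Subgroup G), ρ (d : G) x₀) = 0 :=
      hφA _ fun g => apply_sum_subgroup ρ hmul ⊤ (Subgroup.mem_top g) x₀
    rw [apply_sum_subgroup_eq ρ ⊤ φ (fun g => (χ g : ℂ)) hφχ
      (fun c _ => by rw [h1, MonoidHom.one_apply, Units.val_one]) x₀] at hN
    refine hx₀ ((mul_eq_zero.mp hN).resolve_left ?_)
    exact Nat.cast_ne_zero.mpr Fintype.card_ne_zero
  -- the witness `w ∈ M^(χ)` with `φ w ≠ 0`
  obtain ⟨g₀, n, hn, hζ, hgen⟩ := exists_generator_of_character χ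
  -- `C = ker χ`, kept opaque so that all sums over it carry the classical `Fintype` instance
  obtain ⟨C, hC⟩ : ∃ C : Subgroup G, C = χ.ker := ⟨_, rfl⟩
  have hmemC : ∀ c : G, c ∈ C ↔ χ c = 1 := fun c => by rw [hC, MonoidHom.mem_ker]
  set Ψ : ℤ[X] := ∏ d ∈ n.properDivisors, cyclotomic d ℤ with hΨ
  set y₀ : M := aeval (ρ g₀).toIntLinearMap Ψ x₀ with hy₀
  set w : M := ∑ d : C, ρ (d : G) y₀ with hw
  have hwC : ∀ c : G, χ c = 1 → ρ c w = w := fun c hc =>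
    apply_witness ρ hmul C ((hmemC c).mpr hc) y₀
  have hgn : g₀ ^ n ∈ C := by
    rw [hmemC, map_pow, ← Units.val_inj, Units.val_pow_eq_pow_val, Units.val_one]
    exact hζ.pow_eq_one
  have hwΦ : aeval (ρ g₀).toIntLinearMap (cyclotomic n ℤ) w = 0 := by
    rw [hw, hy₀, hΨ]
    exact aeval_cyclotomic_witness_eq_zero ρ hmul hone hn g₀ C hgn x₀
  have hwχ : w ∈ chiPart ρ (fun g => (χ g : ℂ)) :=
    mem_chiPart_of_cyclotomic ρ hmul hone χ hn hζ hgen hwC hwΦ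
  have hφw : φ w = (Fintype.card C : ℂ) * (aeval (χ g₀ : ℂ) Ψ * φ x₀) := by
    rw [hw, hy₀, hΨ]
    exact apply_witness_eq ρ hmul hone C φ (fun g => (χ g : ℂ)) hφχ
      (fun c hc => by rw [(hmemC c).mp hc, Units.val_one]) g₀ n x₀
  have hφw0 : φ w ≠ 0 := by
    rw [hφw]
    exact mul_ne_zero (Nat.cast_ne_zero.mpr Fintype.card_ne_zero)
      (mul_ne_zero (aeval_prod_properDivisors_ne_zero hn hζ) hx₀)
  -- but `w` is torsion
  obtain ⟨k, hk, hkw⟩ := (htors χ hχ1 hχker w hwχ).exists_nsmul_eq_zero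
  have h := congrArg φ hkw
  rw [map_nsmul, map_zero, nsmul_eq_mul, mul_eq_zero] at h
  exact h.elim (fun h => hk.ne' (Nat.cast_eq_zero.mp h)) hφw0

include hmul hone in
/-- **`rank_ℤ M = rank_ℤ M^G`** under the hypothesis of `exists_nsmul_forall_apply_eq`: the
quotient `M / M^G` is torsion, so its rank vanishes (rank–nullity over `ℤ`). Here `MG` is any
`ℤ`-submodule whose elements are exactly the `G`-fixed vectors. [folklore] -/
theorem finrank_eq_finrank_of_chiPart_torsion [Module.Finite ℤ M]
    (htors : ∀ χ : G →* ℂˣ, χ ≠ 1 → (∀ g : G, (∀ x : M, ρ g x = x) → χ g = 1) →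
      ∀ x ∈ chiPart ρ (fun g => (χ g : ℂ)), IsOfFinAddOrder x)
    (MG : Submodule ℤ M) (hMG : ∀ y : M, y ∈ MG ↔ ∀ g : G, ρ g y = y) :
    Module.finrank ℤ M = Module.finrank ℤ MG := by
  haveI : Module.Finite ℤ (M ⧸ MG) := Module.Finite.quotient ℤ MG
  have htor : Module.IsTorsion ℤ (M ⧸ MG) := by
    intro q
    induction q using Submodule.Quotient.induction_on with
    | H x =>
      obtain ⟨n, hn, hnx⟩ := exists_nsmul_forall_apply_eq ρ hmul hone htors x
      refine ⟨⟨n, mem_nonZeroDivisors_of_ne_zero (by exact_mod_cast hn.ne')⟩, ?_⟩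
      change ((n : ℤ) • MG.mkQ x : M ⧸ MG) = 0
      rw [← map_zsmul, Submodule.mkQ_apply, Submodule.Quotient.mk_eq_zero, natCast_zsmul, hMG]
      exact hnx
  have h0 : Module.finrank ℤ (M ⧸ MG) = 0 := Module.finrank_eq_zero_iff_isTorsion.mpr htor
  -- (the two `ℤ`-module structures on `↥MG` / `M ⧸ MG` agree definitionally, not syntactically)
  calc Module.finrank ℤ M = Module.finrank ℤ (M ⧸ MG) + Module.finrank ℤ MG :=
        (Submodule.finrank_quotient_add_finrank MG).symm
    _ = Module.finrank ℤ MG := by rw [h0, zero_add]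

/-! ### The form used by the item: `rank M^H = rank M^G` -/

include hmul hone in
/-- **`rank_ℤ M^H = rank_ℤ M^G`.** Let the finite commutative group `G` act additively on the
finitely generated abelian group `M`, let `H ≤ G`, and suppose that for every non-trivial
character `χ : G → ℂˣ` trivial on `H` the `χ`-part `M^(χ)` is torsion (for `M = E(ℚ(ζ_m))` this
is Kato's Cor. 14.3 (2) when `L(E, χ, 1) ≠ 0`). Then the `H`-fixed and the `G`-fixed vectors have
the same `ℤ`-rank (`MH`, `MG` are any `ℤ`-submodules with exactly these elements): the core
`finrank_eq_finrank_of_chiPart_torsion` applied to the induced action on `M^H`, whose kernel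
contains `H` and whose `χ`-parts embed in those of `M`. [folklore] -/
theorem finrank_fixed_eq_finrank_fixed_of_subgroup [Module.Finite ℤ M] (H : Subgroup G)
    (htors : ∀ χ : G →* ℂˣ, (∀ h ∈ H, χ h = 1) → χ ≠ 1 →
      ∀ x ∈ chiPart ρ (fun g => (χ g : ℂ)), IsOfFinAddOrder x)
    (MH : Submodule ℤ M) (hMH : ∀ y : M, y ∈ MH ↔ ∀ h ∈ H, ρ h y = y)
    (MG : Submodule ℤ M) (hMG : ∀ y : M, y ∈ MG ↔ ∀ g : G, ρ g y = y) :
    Module.finrank ℤ MH = Module.finrank ℤ MG := by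
  -- the induced action on `M^H`
  have hstab : ∀ (g : G) (y : M), y ∈ MH → ρ g y ∈ MH := fun g y hy => by
    rw [hMH] at hy ⊢
    intro h hh
    rw [← hmul, mul_comm, hmul, hy h hh]
  let ρH : G → MH →+ MH := fun g =>
    { toFun := fun y => ⟨ρ g y, hstab g y y.2⟩
      map_zero' := Subtype.ext (map_zero _)
      map_add' := fun a b => Subtype.ext (map_add _ _ _) }
  have hρH : ∀ (g : G) (y : MH), ((ρH g y : MH) : M) = ρ g y := fun _ _ => rfl
  have hmulH : ∀ (g h : G) (y : MH), ρH (g * h) y = ρH g (ρH h y) := fun g h y =>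
    Subtype.ext (by rw [hρH, hρH, hρH, hmul])
  have honeH : ∀ y : MH, ρH 1 y = y := fun y => Subtype.ext (by rw [hρH, hone])
  -- its `χ`-parts
  have htorsH : ∀ χ : G →* ℂˣ, χ ≠ 1 → (∀ g : G, (∀ y : MH, ρH g y = y) → χ g = 1) →
      ∀ y ∈ chiPart ρH (fun g => (χ g : ℂ)), IsOfFinAddOrder y := by
    intro χ hχ1 hχker y hy
    have hH : ∀ h ∈ H, χ h = 1 := fun h hh => hχker h fun z => Subtype.ext (by
      rw [hρH]
      exact (hMH z).mp z.2 h hh)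
    have hy' : (y : M) ∈ chiPart ρ (fun g => (χ g : ℂ)) := by
      intro a ha
      have h := congrArg Subtype.val (hy a ha)
      simp only [Finsupp.sum, AddSubmonoidClass.coe_finsetSum, Submodule.coe_smul_of_tower, hρH,
        Submodule.coe_zero] at h
      simpa only [Finsupp.sum] using h
    obtain ⟨k, hk, hky⟩ := (htors χ hH hχ1 _ hy').exists_nsmul_eq_zero
    exact isOfFinAddOrder_iff_nsmul_eq_zero.mpr ⟨k, hk, Subtype.ext (by
      rw [Submodule.coe_smul_of_tower, Submodule.coe_zero]
      exact hky)⟩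
  -- `G`-fixed vectors inside `M^H`
  let MHG : Submodule ℤ MH := MG.comap MH.subtype
  have hMHG : ∀ y : MH, y ∈ MHG ↔ ∀ g : G, ρH g y = y := fun y => by
    rw [Submodule.mem_comap, Submodule.subtype_apply, hMG]
    exact ⟨fun h g => Subtype.ext (h g), fun h g => congrArg Subtype.val (h g)⟩
  have hle : MG ≤ MH := fun y hy => by
    rw [hMG] at hy
    rw [hMH]
    exact fun h _ => hy h
  rw [finrank_eq_finrank_of_chiPart_torsion ρH hmulH honeH htorsH MHG hMHG]
  exact (Submodule.comapSubtypeEquivOfLe hle).finrank_eq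

end KatoDescent

end Summit.BirchSwinnertonDyer.BirchSwinnertonDyer.Theorems

end
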